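import Literature.Probability.Percolation.SlabRSWHalfSide
import HarnessLib

/-!
# Newman–Tassion–Wu 2017, §3.6 (proof of Theorem 3.17): the square-root trick over the segments of a
# side — some segment of length `n` of the left side is joined to the right side with probability
# `≥ 1 - (1 - f)^{1/L}`

Topic: `Literature/Probability/Percolation`. NTW, proof of Theorem 3.17 (p. 18): "Let
`R = [1,1+3c₁n]×[−2c₁n,2c₁n]`. By symmetry and the square root trick, there exists `y ∈ {0,n,…,(2c₁−1)n}`
such that `{1}×[y,y+n]` is connected in `R` to the right side `R(R)` with probability larger than
`1 − (1−f(3c₁n,4c₁n))^{1/4c₁}`." Here, without the symmetry halving: in `R = [a,b]×[c, c+Ln+L-1]`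
(left side cut into `L ≥ 1` segments `{a}×[c+jn+j… ]` — we use `L` consecutive segments of `n+1` rows),
some segment is joined inside `R` to the right side with probability `≥ 1 − (1 − P[L(R) ⟷^R R(R)])^{1/L}`.

* `real_leftSeg_right_ge` — PROVED (`sqrt_trick_holds` over `Fin L`).

## Sources

* C. M. Newman, V. Tassion, W. Wu, *Critical percolation and the minimal spanning tree in slabs*,
  Comm. Pure Appl. Math. 70 (2017), arXiv:1512.09107: §3.6, proof of Theorem 3.17 (choice of `y`)
  [NewmanTassionWu2017]; Grimmett 1999 (11.14) (the tree's `sqrt_trick_holds`).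
-/

noncomputable section

namespace Literature.Probability.Percolation

open MeasureTheory LatticeModels SimpleGraph

namespace NTW17

variable {k : ℕ}

/-- **Square-root trick over the segments of the left side.** In `R = [a,b]×[c, c+L(n+1)-1]` with the
left side cut into the `L ≥ 1` segments `{a}×[c+j(n+1), c+j(n+1)+n]` (`j < L`), some segment is joined
inside `R` to the right side `{x = b}` with probability at least `1 − (1 − P_p[{x=a} ⟷^R {x=b}])^{1/L}`.
[cite: NewmanTassionWu2017, §3.6 (proof of Theorem 3.17: "by symmetry and the square root trick, there exists y …")] -/
theorem real_leftSeg_right_ge (a b c : ℤ) (n L : ℕ) (hL : 1 ≤ L) (p : unitInterval) :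
    ∃ j : ℕ, j < L ∧
      1 - (1 - (bondPercolation (slabGraph 3 k) p).real
          (slabConn k (boxR a b c (c + L * (n + 1) - 1)) {z | z.1 = a} {z | z.1 = b})) ^ ((L : ℝ)⁻¹) ≤
        (bondPercolation (slabGraph 3 k) p).real
          (slabConn k (boxR a b c (c + L * (n + 1) - 1)) (sideSeg a (c + j * (n + 1)) (c + j * (n + 1) + n))
            {z | z.1 = b}) := by
  classical
  set P := bondPercolation (slabGraph 3 k) p with hP
  set R := boxR a b c (c + L * (n + 1) - 1) with hRdef
  haveI : Nonempty (Fin L) := ⟨⟨0, hL⟩⟩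
  let A : Fin L → Set (BondConfig (slab 3 k)) := fun j =>
    slabConn k R (sideSeg a (c + (j : ℕ) * (n + 1)) (c + (j : ℕ) * (n + 1) + n)) {z | z.1 = b}
  have hAup : ∀ j, IsUpperSet (A j) := fun j => isUpperSet_openCrossing _ _ _
  have hAm : ∀ j, MeasurableSet (A j) := fun j => measurableSet_slabConn_boxR _ _ _ _ _ _
  -- the left-right crossing is covered by the union
  have hcover : slabConn k R {z | z.1 = a} {z | z.1 = b} ⊆ ⋃ j, A j := by
    intro ω hω
    obtain ⟨l, hl⟩ := (mem_slabConn_iff_exists_isOSAP ω _ _ _).1 hω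
    have hx := hl.head_mem hl.ne_nil
    have hxS := hl.subset _ (List.head_mem hl.ne_nil)
    rw [mem_slabLift_iff, Set.mem_setOf_eq] at hx
    rw [mem_slabLift_iff] at hxS
    have hxS' : planar k (l.head hl.ne_nil) ∈ boxR a b c (c + L * (n + 1) - 1) := hxS
    rw [mem_boxR_iff] at hxS'
    -- the segment containing the starting row
    set y := (planar k (l.head hl.ne_nil)).2 with hy
    have hy0 : 0 ≤ y - c := by omega
    obtain ⟨q, hq⟩ : ∃ q : ℕ, (q : ℤ) = (y - c) / (n + 1) := ⟨((y - c) / (n + 1)).toNat, by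
      rw [Int.toNat_of_nonneg (Int.ediv_nonneg hy0 (by positivity))]⟩
    have hn1 : (0 : ℤ) < n + 1 := by positivity
    have hq1 : (q : ℤ) * (n + 1) ≤ y - c := by rw [hq]; exact Int.ediv_mul_le _ (ne_of_gt hn1)
    have hq2 : y - c < ((q : ℤ) + 1) * (n + 1) := by
      rw [hq]; exact Int.lt_ediv_add_one_mul_self _ hn1
    have hqL : q < L := by
      have h1 : (q : ℤ) * (n + 1) ≤ L * (n + 1) - 1 := by omega
      by_contra hcon
      push Not at hcon
      have : (L : ℤ) * (n + 1) ≤ (q : ℤ) * (n + 1) := by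
        exact mul_le_mul_of_nonneg_right (by exact_mod_cast hcon) hn1.le
      omega
    refine Set.mem_iUnion.2 ⟨⟨q, hqL⟩, ?_⟩
    refine (mem_slabConn_iff_exists_isOSAP ω _ _ _).2 ⟨l, ⟨hl.nodup, hl.chain, hl.subset, hl.ne_nil,
      fun h => ?_, hl.last_mem⟩⟩
    rw [mem_slabLift_iff, sideSeg, Set.mem_setOf_eq]
    refine ⟨hx, ?_, ?_⟩ <;> push_cast <;> nlinarith [hq1, hq2]
  obtain ⟨j, hj⟩ := sqrt_trick_holds (slabGraph 3 k) p A hAup hAm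
  refine ⟨j, j.isLt, ?_⟩
  have hcard : (Fintype.card (Fin L) : ℝ) = L := by simp
  rw [hcard] at hj
  refine le_trans ?_ hj
  have hmono : P.real (slabConn k R {z | z.1 = a} {z | z.1 = b}) ≤ P.real (⋃ i, A i) :=
    measureReal_mono hcover (measure_ne_top _ _)
  have h1 : P.real (⋃ i, A i) ≤ 1 := measureReal_le_one
  have hL0 : 0 ≤ ((L : ℝ))⁻¹ := by positivity
  have := Real.rpow_le_rpow (by linarith) (by linarith : 1 - P.real (⋃ i, A i) ≤
    1 - P.real (slabConn k R {z | z.1 = a} {z | z.1 = b})) hL0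
  linarith

end NTW17

end Literature.Probability.Percolation

end
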